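import Literature.MathematicalPhysics.QuantumLattice.HubbardNNNHopping
import Literature.MathematicalPhysics.QuantumLattice.HubbardTorusFluxGauge
import HarnessLib

/-!
# The flux-threaded `t–t'` Hubbard torus (next-nearest-neighbour hopping under a twist)

Topic `Literature/MathematicalPhysics/QuantumLattice` (family `hubbard`); companion of
`HubbardNNNHopping.lean` (`hubbardTorusTT'`, Xu et al. 2024 eq. (1)) and `HubbardTorusFlux(Gauge).lean`
(`hubbardTorusFlux L U θ`, `seamFluxConfig`, `twistGauge`). Definitions + PROVED statements only.

* Bond bookkeeping of `torusDiagGraph L` for `L ≥ 3`: the four diagonal neighbours `x ± j_s`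
  (`j_0 = e₁ + e₂`, `j_1 = e₁ − e₂`, `torusDiagJump`) are pairwise distinct, so ordered adjacent
  pairs are the ORIENTED diagonal bonds met in both orders (`sum_sum_ite_torusDiagGraph_adj`), and
  `hamiltonian (fermionTorusDiagGraph L) t' 0 = -t' • diagPeierlsHopping L 1`.
* `diagPeierlsHopping L a` — diagonal hopping with Peierls amplitudes `a_s(x)` on the oriented
  bonds `x → x + j_s` (Lieb 1994 eq. (1)); `diagSeamTwist L θ` — the Peierls correction
  `(1 − e^{±iθ})` of the diagonal bonds leaving the column `x₁ = -1` (Watanabe 2019 §2.2.3, §4.1: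
  under the twisted boundary condition EVERY term of a finite-range Hamiltonian crossing the seam
  acquires the phase; both diagonal jumps move `x₁` by `+1`, so they twist like the `e₁`-bonds).
* `hubbardTorusTT'Flux L t' U θ = hubbardTorusTT' L 1 t' U + (seamTwist L θ + t' • diagSeamTwist L θ)`
  — the **`t–t'` Hubbard torus (`t = 1`) with flux `θ`**, and its flux envelope
  `fluxEnergyTT' L t' U δ θ` (lowest energy in the sector `N_L = 2⌊(1-δ)L²/2⌋`, `S^z = 0`), whose
  stiffness in `θ/L` is the superfluid weight of Scalapino–White–Zhang 1993 §II /
  Hazra–Verma–Randeria 2019 eqs. (2)–(4) for the `t–t'` band.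
* PROVED: `t' = 0` ↦ `hubbardTorusFlux`; `θ = 0` ↦ `hubbardTorusTT' L 1 t' U`; seam gauge form of the
  diagonal part (`L ≥ 3`); hermiticity; conservation of `N↑, N↓`; `conj H(θ) = H(−θ)`, `E(−θ) = E(θ)`.
* NOT here (companion `HubbardNNNHoppingFluxStiffness.lean`): the uniform gauge, the Rayleigh
  expansion in the flux and the f-sum floor `ρ_s L² ≤ K_x + t' K_diag` on sector ground states.

References: H. Watanabe, J. Stat. Phys. 177 (2019) 717, §2.2.3, §4.1 [Watanabe2019]; H. Xu et al.,
Science 384 (2024) eadh7691, eq. (1) [XuEtAl2024]; E. H. Lieb, PRL 73 (1994) 2158, eq. (1)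
[Lieb1994]; D. J. Scalapino, S. R. White, S. C. Zhang, PRB 47 (1993) 7995, §II
[ScalapinoWhiteZhang1993]; T. Hazra, N. Verma, M. Randeria, PRX 9 (2019) 031049, eqs. (2)–(4)
[HazraVermaRanderia2019]; N. Byers, C. N. Yang, PRL 7 (1961) 46 [ByersYang1961].
-/

noncomputable section

namespace Literature.MathematicalPhysics.QuantumLattice

open Matrix Finset Literature.MathematicalPhysics.QuantumFieldTheory
  Literature.Probability.LatticeModels
open scoped ComplexConjugate

variable {L : ℕ}

/-! ### The diagonal jumps of `(ℤ/L)²` -/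

/-- Both diagonal jumps move the first coordinate by `+1`. [folklore] -/
@[simp] private theorem torusDiagJump_apply_zero (s : Fin 2) : torusDiagJump L s 0 = 1 := by
  simp [torusDiagJump]

/-- The diagonal jumps are nonzero for `L ≥ 2`. [folklore] -/
private theorem torusDiagJump_ne_zero (hL : 2 ≤ L) (s : Fin 2) : torusDiagJump L s ≠ 0 := by
  intro h
  have h0 := congrFun h 0
  rw [torusDiagJump_apply_zero, Pi.zero_apply] at h0
  exact zmod_one_ne_zero_of_two_le hL h0

/-- `e₁ + e₂ ≠ e₁ − e₂` in `(ℤ/L)²` for `L ≥ 3` (it fails for `L = 2`). [folklore] -/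
private theorem torusDiagJump_zero_ne_one (hL : 3 ≤ L) : torusDiagJump L 0 ≠ torusDiagJump L 1 := by
  intro h
  have h1 := congrFun h 1
  simp only [torusDiagJump, Fin.isValue, if_true, one_ne_zero, if_false] at h1
  exact zmod_one_add_one_ne_zero_of_three_le hL (eq_neg_iff_add_eq_zero.mp h1)

/-- `j_s + j_{s'} ≠ 0` in `(ℤ/L)²` for `L ≥ 3` (first coordinate `1 + 1 ≠ 0`). [folklore] -/
private theorem torusDiagJump_add_ne_zero (hL : 3 ≤ L) (s s' : Fin 2) :
    torusDiagJump L s + torusDiagJump L s' ≠ 0 := by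
  intro h
  have h0 := congrFun h 0
  rw [Pi.add_apply, torusDiagJump_apply_zero, torusDiagJump_apply_zero, Pi.zero_apply] at h0
  exact zmod_one_add_one_ne_zero_of_three_le hL h0

/-- Diagonal adjacency on `(ℤ/L)²`, `L ≥ 2`: `x ∼ y` iff `y = x ± j_s` for some `s`. [folklore] -/
private theorem torusDiagGraph_adj_iff (hL : 2 ≤ L) (x y : Site 2 L) :
    (torusDiagGraph L).Adj x y ↔
      (∃ s, y = x + torusDiagJump L s) ∨ ∃ s, y = x - torusDiagJump L s := by
  rw [torusDiagGraph, SimpleGraph.fromRel_adj]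
  constructor
  · rintro ⟨-, h | ⟨s, h⟩⟩
    · exact Or.inl h
    · exact Or.inr ⟨s, by rw [h, add_sub_cancel_right]⟩
  · rintro (⟨s, h⟩ | ⟨s, h⟩)
    · refine ⟨?_, Or.inl ⟨s, h⟩⟩
      rw [h]
      intro hx
      exact torusDiagJump_ne_zero hL s (by simpa using hx.symm)
    · refine ⟨?_, Or.inr ⟨s, by rw [h, sub_add_cancel]⟩⟩
      rw [h]
      intro hx
      exact torusDiagJump_ne_zero hL s (by simpa [sub_eq_add_neg] using hx)

/-! ### Bond bookkeeping of the diagonal graph (`L ≥ 3`) -/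

variable [NeZero L]

/-- Diagonal neighbour sum, `L ≥ 3`: over the four *distinct* sites `x ± j_s`. [folklore] -/
private theorem sum_ite_torusDiagGraph_adj {M : Type*} [AddCommMonoid M] (hL : 3 ≤ L)
    (x : Site 2 L) (g : Site 2 L → M) :
    (∑ y : Site 2 L, if (torusDiagGraph L).Adj x y then g y else 0) =
      ∑ s, g (x + torusDiagJump L s) + ∑ s, g (x - torusDiagJump L s) := by
  have hL2 : 2 ≤ L := by omega
  have hne : ∀ {a b : Site 2 L}, a ≠ b → x + a ≠ x + b := fun h h' => h (add_left_cancel h')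
  have hns : ∀ {a b : Site 2 L}, a + b ≠ 0 → x + a ≠ x - b := fun h h' =>
    h (eq_neg_iff_add_eq_zero.mp (add_left_cancel (h'.trans (sub_eq_add_neg x _))))
  have hss : ∀ {a b : Site 2 L}, a ≠ b → x - a ≠ x - b := fun h h' => h (sub_right_inj.mp h')
  have h12 := hne (torusDiagJump_zero_ne_one hL)
  have h13 := hns (torusDiagJump_add_ne_zero hL 0 0)
  have h14 := hns (torusDiagJump_add_ne_zero hL 0 1)
  have h23 := hns (torusDiagJump_add_ne_zero hL 1 0)
  have h24 := hns (torusDiagJump_add_ne_zero hL 1 1)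
  have h34 := hss (torusDiagJump_zero_ne_one hL)
  have key : ∀ y : Site 2 L,
      (if (torusDiagGraph L).Adj x y then g y else 0) =
        (∑ s, if y = x + torusDiagJump L s then g y else 0) +
          ∑ s, if y = x - torusDiagJump L s then g y else 0 := by
    intro y
    simp only [torusDiagGraph_adj_iff hL2, Fin.exists_fin_two, Fin.sum_univ_two]
    by_cases ha : y = x + torusDiagJump L 0
    · subst ha
      simp only [h12, h13, h14, or_false, reduceIte, add_zero]
    by_cases hb : y = x + torusDiagJump L 1
    · subst hb
      simp only [h12.symm, h23, h24, or_false, or_true, reduceIte, add_zero, zero_add]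
    by_cases hc : y = x - torusDiagJump L 0
    · subst hc
      simp only [h13.symm, h23.symm, h34, or_false, or_true, reduceIte, add_zero, zero_add]
    by_cases hd : y = x - torusDiagJump L 1
    · subst hd
      simp only [h14.symm, h24.symm, h34.symm, or_true, reduceIte, zero_add]
    simp only [ha, hb, hc, hd, or_self, reduceIte, add_zero]
  simp_rw [key, Finset.sum_add_distrib]
  congr 1
  · rw [Finset.sum_comm]
    simp
  · rw [Finset.sum_comm]
    simp

/-- **Ordered diagonal pairs, `L ≥ 3`, are the oriented diagonal bonds** (both orders). [folklore] -/
private theorem sum_sum_ite_torusDiagGraph_adj {M : Type*} [AddCommMonoid M] (hL : 3 ≤ L)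
    (F : Site 2 L → Site 2 L → M) :
    (∑ x : Site 2 L, ∑ y : Site 2 L, if (torusDiagGraph L).Adj x y then F x y else 0) =
      ∑ x : Site 2 L, ∑ s : Fin 2,
        (F (x + torusDiagJump L s) x + F x (x + torusDiagJump L s)) := by
  have hre : ∀ s : Fin 2, ∑ x : Site 2 L, F x (x - torusDiagJump L s) =
      ∑ x : Site 2 L, F (x + torusDiagJump L s) x := fun s =>
    Fintype.sum_equiv (Equiv.subRight (torusDiagJump L s)) _ _ fun x => by
      simp only [Equiv.subRight_apply, sub_add_cancel]
  calc (∑ x : Site 2 L, ∑ y : Site 2 L, if (torusDiagGraph L).Adj x y then F x y else 0)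
      = ∑ x : Site 2 L, ((∑ s, F x (x + torusDiagJump L s)) + ∑ s, F x (x - torusDiagJump L s)) :=
        Finset.sum_congr rfl fun x _ => sum_ite_torusDiagGraph_adj hL x (F x)
    _ = (∑ x : Site 2 L, ∑ s, F x (x + torusDiagJump L s)) +
          ∑ x : Site 2 L, ∑ s, F x (x - torusDiagJump L s) := Finset.sum_add_distrib
    _ = (∑ x : Site 2 L, ∑ s, F x (x + torusDiagJump L s)) +
          ∑ x : Site 2 L, ∑ s, F (x + torusDiagJump L s) x := by
        congr 1
        rw [Finset.sum_comm]
        simp only [hre]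
        exact Finset.sum_comm
    _ = ∑ x : Site 2 L, ∑ s : Fin 2, (F (x + torusDiagJump L s) x + F x (x + torusDiagJump L s)) := by
        rw [add_comm, ← Finset.sum_add_distrib]
        exact Finset.sum_congr rfl fun x _ => Finset.sum_add_distrib.symm

/-- The diagonal hopping term transported to `(ℤ/L)²`-indexed sums. [folklore] -/
private theorem sum_fermionTorusDiagGraph_adj_eq_sum_torusDiagGraph_adj :
    (∑ u : FermionTorus 2 L, ∑ v : FermionTorus 2 L, ∑ σ : Fin 2,
        if (fermionTorusDiagGraph L).Adj u v then creation (orb u σ) * annihilation (orb v σ)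
        else 0) =
      ∑ x : Site 2 L, ∑ y : Site 2 L,
        if (torusDiagGraph L).Adj x y then
          ∑ σ : Fin 2, creation (orb (FermionTorus.ofTorusSite x) σ) *
            annihilation (orb (FermionTorus.ofTorusSite y) σ)
        else 0 := by
  refine Fintype.sum_equiv FermionTorus.equivTorusSite _ _ fun u => ?_
  refine Fintype.sum_equiv FermionTorus.equivTorusSite _ _ fun v => ?_
  rw [Finset.sum_ite_irrel, Finset.sum_const_zero]
  simp only [FermionTorus.equivTorusSite, Equiv.coe_fn_mk, FermionTorus.ofTorusSite_toTorusSite]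
  rfl

/-! ### Diagonal hopping with Peierls amplitudes; the diagonal seam twist -/

section Defs

variable (L)

/-- The **diagonal hopping of `(ℤ/L)²` with Peierls amplitudes** `a_s(x)` on the oriented
next-nearest-neighbour bonds `x → x + j_s`: `Σ_{s,x,σ} [a_s(x) c†_{x+j_s,σ} c_{x,σ} + conj a_s(x)
c†_{x,σ} c_{x+j_s,σ}]` (Peierls substitution, Lieb PRL 73 (1994) eq. (1)). [cite: Lieb1994, eq. (1)] -/
def diagPeierlsHopping (a : Fin 2 → Site 2 L → ℂ) :
    Matrix (Finset (Orb (FermionTorus 2 L))) (Finset (Orb (FermionTorus 2 L))) ℂ :=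
  ∑ s : Fin 2, ∑ x : Site 2 L, ∑ σ : Fin 2,
    (a s x • (creation (orb (FermionTorus.ofTorusSite (x + torusDiagJump L s)) σ) *
        annihilation (orb (FermionTorus.ofTorusSite x) σ)) +
      conj (a s x) • (creation (orb (FermionTorus.ofTorusSite x) σ) *
        annihilation (orb (FermionTorus.ofTorusSite (x + torusDiagJump L s)) σ)))

/-- The **diagonal seam twist** with flux `θ`: the Peierls correction of the diagonal bonds
`x → x + j_s` leaving the column `x₁ = -1` (both jumps move `x₁` by `+1`):
`Σ_{s, x : x₁ = -1, σ} [(1 − e^{iθ}) c†_{x+j_s,σ} c_{x,σ} + (1 − e^{-iθ}) c†_{x,σ} c_{x+j_s,σ}]`; with weight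
`t'` it replaces the seam-crossing diagonal amplitudes `-t'` by `-t' e^{±iθ}`, as `seamTwist L θ` does
for the nearest-neighbour bonds (Watanabe 2019 §2.2.3: every term of the Hamiltonian across the
seam acquires the phase; §4.1: two dimensions). [cite: Watanabe2019, §2.2.3 and §4.1] -/
def diagSeamTwist (θ : ℝ) :
    Matrix (Finset (Orb (FermionTorus 2 L))) (Finset (Orb (FermionTorus 2 L))) ℂ :=
  ∑ s : Fin 2, ∑ x : Site 2 L, ∑ σ : Fin 2, if x 0 = -1 then
      ((1 - ((Circle.exp θ : Circle) : ℂ)) •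
          (creation (orb (FermionTorus.ofTorusSite (x + torusDiagJump L s)) σ) *
            annihilation (orb (FermionTorus.ofTorusSite x) σ)) +
        (1 - conj ((Circle.exp θ : Circle) : ℂ)) •
          (creation (orb (FermionTorus.ofTorusSite x) σ) *
            annihilation (orb (FermionTorus.ofTorusSite (x + torusDiagJump L s)) σ)))
    else 0

/-- The **`t–t'` Hubbard torus with flux `θ` through the `e₁`-cycle** (`t = 1`): `hubbardTorusTT' L 1 t' U`
(Xu et al. 2024 eq. (1)) under the twisted boundary condition — every hopping across the seam
`{x₁ = -1} → {x₁ = 0}`, nearest-neighbour (`seamTwist`) and diagonal (`t' • diagSeamTwist`) alike,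
carries the phase `e^{±iθ}` (Watanabe 2019 §2.2.3, §4.1; Scalapino–White–Zhang 1993 §II). At `t' = 0`
it is the tree's `hubbardTorusFlux L U θ`. [cite: Watanabe2019, §2.2.3 and §4.1] -/
def hubbardTorusTT'Flux (t' U θ : ℝ) :
    Matrix (Finset (Orb (FermionTorus 2 L))) (Finset (Orb (FermionTorus 2 L))) ℂ :=
  hubbardTorusTT' L 1 t' U + (seamTwist L θ + (t' : ℂ) • diagSeamTwist L θ)

/-- The **flux envelope of the `t–t'` torus** `E^{tt'}_L(t', U, δ; θ)`: the lowest energy of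
`hubbardTorusTT'Flux L t' U θ` in the joint sector of `N_L = 2⌊(1-δ)L²/2⌋` electrons and `S^z = 0`
(`Matrix.minEnergyOn (szSector N_L 0)`); its stiffness in `θ/L` is the superfluid weight `D_s` of the
`t–t'` band in the sense of Scalapino–White–Zhang (1993) §II, the quantity bounded by the kinetic
energy in Hazra–Verma–Randeria (2019) eqs. (2)–(4). [cite: ScalapinoWhiteZhang1993, §II] -/
def fluxEnergyTT' (t' U δ θ : ℝ) : ℝ :=
  (hubbardTorusTT'Flux L t' U θ).minEnergyOn (szSector (2 * ⌊(1 - δ) * (L : ℝ) ^ 2 / 2⌋₊) 0)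

/-- `hubbardTorusTT'Flux` is the `t–t'` torus plus the two seam twists (definitional).
[cite: Watanabe2019, §2.2.3 and §4.1] -/
theorem hubbardTorusTT'Flux_eq (t' U θ : ℝ) :
    hubbardTorusTT'Flux L t' U θ =
      hubbardTorusTT' L 1 t' U + (seamTwist L θ + (t' : ℂ) • diagSeamTwist L θ) := rfl

/-- `fluxEnergyTT'` unfolded (definitional). [cite: ScalapinoWhiteZhang1993, §II] -/
theorem fluxEnergyTT'_eq (t' U δ θ : ℝ) :
    fluxEnergyTT' L t' U δ θ =
      (hubbardTorusTT'Flux L t' U θ).minEnergyOn (szSector (2 * ⌊(1 - δ) * (L : ℝ) ^ 2 / 2⌋₊) 0) :=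
  rfl

/-- At zero flux the diagonal seam twist vanishes (`H = H^{(θ)}|_{θ=0}`). [cite: Watanabe2019, §2.2.3] -/
@[simp] theorem diagSeamTwist_zero : diagSeamTwist L 0 = 0 := by
  simp [diagSeamTwist]

/-- At zero flux the twisted torus is `hubbardTorusTT' L 1 t' U` (`H = H^{(θ)}|_{θ=0}`). [cite: Watanabe2019, §2.2.3] -/
@[simp] theorem hubbardTorusTT'Flux_zero (t' U : ℝ) :
    hubbardTorusTT'Flux L t' U 0 = hubbardTorusTT' L 1 t' U := by
  rw [hubbardTorusTT'Flux_eq, seamTwist_zero, diagSeamTwist_zero, smul_zero, add_zero, add_zero]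

/-- At `t' = 0` the twisted `t–t'` torus is the tree's `hubbardTorusFlux L U θ`. [cite: XuEtAl2024, eq. (1)] -/
@[simp] theorem hubbardTorusTT'Flux_tPrime_zero (U θ : ℝ) :
    hubbardTorusTT'Flux L 0 U θ = hubbardTorusFlux L U θ := by
  rw [hubbardTorusTT'Flux_eq, hubbardTorusTT'_zero, Complex.ofReal_zero, zero_smul, add_zero,
    hubbardTorusFlux_eq]

/-- At `t' = 0` the `t–t'` flux envelope is the tree's `fluxEnergy L U δ θ`. [cite: XuEtAl2024, eq. (1)] -/
@[simp] theorem fluxEnergyTT'_tPrime_zero (U δ θ : ℝ) :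
    fluxEnergyTT' L 0 U δ θ = fluxEnergy L U δ θ := by
  rw [fluxEnergyTT'_eq, hubbardTorusTT'Flux_tPrime_zero, fluxEnergy_eq]

/-- Regrouping: the twisted `t–t'` torus is the twisted nearest-neighbour torus plus the diagonal
part `hamiltonian (fermionTorusDiagGraph L) t' 0 + t' • diagSeamTwist L θ`. [cite: XuEtAl2024, eq. (1)] -/
theorem hubbardTorusTT'Flux_eq_hubbardTorusFlux_add (t' U θ : ℝ) :
    hubbardTorusTT'Flux L t' U θ = hubbardTorusFlux L U θ +
      (hamiltonian (fermionTorusDiagGraph L) t' 0 + (t' : ℂ) • diagSeamTwist L θ) := by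
  rw [hubbardTorusTT'Flux_eq, hubbardTorusTT', hubbardTorusFlux_eq, hubbardTorus]
  abel

end Defs

/-! ### The diagonal part as a Peierls bond sum (`L ≥ 3`) -/

/-- **The diagonal hopping term is an oriented bond sum** (`L ≥ 3`):
`hamiltonian (fermionTorusDiagGraph L) t' U' = -t' • diagPeierlsHopping L 1 + U' Σ_y n_{y↑} n_{y↓}`
(the `Σ_{⟨⟨ij⟩⟩}` of Xu et al. 2024 eq. (1): every diagonal bond of the simple graph is one oriented
bond, met in both orders). [cite: XuEtAl2024, eq. (1)] -/
theorem hamiltonian_fermionTorusDiagGraph_eq_smul_diagPeierlsHopping (hL : 3 ≤ L) (t' U' : ℝ) :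
    hamiltonian (fermionTorusDiagGraph L) t' U' =
      -(t' : ℂ) • diagPeierlsHopping L (fun _ _ => 1) +
        (U' : ℂ) • ∑ y : FermionTorus 2 L, numberOp y 0 * numberOp y 1 := by
  have h := sum_sum_ite_torusDiagGraph_adj hL fun x y : Site 2 L =>
    ∑ σ : Fin 2, creation (orb (FermionTorus.ofTorusSite x) σ) *
      annihilation (orb (FermionTorus.ofTorusSite y) σ)
  simp only [hamiltonian, diagPeierlsHopping, map_one, one_smul]
  rw [sum_fermionTorusDiagGraph_adj_eq_sum_torusDiagGraph_adj, h, Finset.sum_comm]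
  simp only [Finset.sum_add_distrib]

/-- **The diagonal part in the seam gauge** (`L ≥ 3`): adding `t' • diagSeamTwist L θ` to the
diagonal hopping term gives the Peierls bond sum whose amplitude on the bond `x → x + j_s` is the
seam gauge field on the `e₁`-edge at `x`, `seamFluxConfig L θ (x, e₁)` (`e^{iθ}` if `x₁ = -1`,
else `1`). Watanabe (2019) §2.2.3; Tada–Koma (2016) §4 (`t̃_{x,y} = t_{x,y} e^{iA_{x,y}}`).
[cite: Watanabe2019, §2.2.3 and §4.1] -/
theorem hamiltonianDiag_add_smul_diagSeamTwist (hL : 3 ≤ L) (t' θ : ℝ) :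
    hamiltonian (fermionTorusDiagGraph L) t' 0 + (t' : ℂ) • diagSeamTwist L θ =
      -(t' : ℂ) • diagPeierlsHopping L
        (fun _ x => ((seamFluxConfig L θ (x, 0) : Circle) : ℂ)) := by
  rw [hamiltonian_fermionTorusDiagGraph_eq_smul_diagPeierlsHopping hL, Complex.ofReal_zero, zero_smul,
    add_zero]
  simp only [diagPeierlsHopping, diagSeamTwist, Finset.smul_sum, ← Finset.sum_add_distrib]
  refine Finset.sum_congr rfl fun s _ => Finset.sum_congr rfl fun x _ =>
    Finset.sum_congr rfl fun σ _ => ?_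
  by_cases hx : x 0 = -1
  · rw [if_pos hx, seamFluxConfig_apply, if_pos ⟨rfl, hx⟩]
    simp only [map_one, one_smul]
    module
  · rw [if_neg hx, seamFluxConfig_apply, if_neg fun h => hx h.2, Circle.coe_one, smul_zero, add_zero]

/-! ### Hermiticity and conservation laws -/

section Symmetry

variable (L)

/-- The Peierls bond sum is Hermitian (`t_{yx} = conj t_{xy}`, Lieb 1994 eq. (1)). [cite: Lieb1994, eq. (1)] -/
theorem isHermitian_diagPeierlsHopping (a : Fin 2 → Site 2 L → ℂ) :
    (diagPeierlsHopping L a).IsHermitian := by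
  unfold Matrix.IsHermitian diagPeierlsHopping
  simp only [conjTranspose_sum]
  refine Finset.sum_congr rfl fun s _ => Finset.sum_congr rfl fun x _ =>
    Finset.sum_congr rfl fun σ _ => ?_
  rw [conjTranspose_add, conjTranspose_smul, conjTranspose_smul,
    conjTranspose_creation_mul_annihilation, conjTranspose_creation_mul_annihilation,
    Complex.star_def, Complex.conj_conj, add_comm]

/-- The diagonal seam twist is Hermitian (the `h.c.` of Watanabe 2019 §2.2.3). [cite: Watanabe2019, §2.2.3] -/
theorem isHermitian_diagSeamTwist (θ : ℝ) : (diagSeamTwist L θ).IsHermitian := by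
  unfold Matrix.IsHermitian diagSeamTwist
  simp only [conjTranspose_sum]
  refine Finset.sum_congr rfl fun s _ => Finset.sum_congr rfl fun x _ =>
    Finset.sum_congr rfl fun σ _ => ?_
  split_ifs
  · rw [conjTranspose_add, conjTranspose_smul, conjTranspose_smul,
      conjTranspose_creation_mul_annihilation, conjTranspose_creation_mul_annihilation,
      star_sub, star_sub, star_one, Complex.star_def, Complex.conj_conj, add_comm]
  · exact conjTranspose_zero

/-- The twisted `t–t'` torus `H^{tt'}(θ)` is Hermitian. [cite: Watanabe2019, §2.2.3 and §4.1] -/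
theorem isHermitian_hubbardTorusTT'Flux (t' U θ : ℝ) : (hubbardTorusTT'Flux L t' U θ).IsHermitian := by
  refine (hubbardTorusTT'_isHermitian L 1 t' U).add ((isHermitian_seamTwist L θ).add ?_)
  unfold Matrix.IsHermitian
  rw [conjTranspose_smul, (isHermitian_diagSeamTwist L θ).eq, Complex.star_def, Complex.conj_ofReal]

/-- The diagonal seam twist conserves `N↑` and `N↓` (spin-diagonal hoppings). [cite: Watanabe2019, §2.1] -/
theorem preservesSectors_diagSeamTwist (θ : ℝ) : PreservesSectors (diagSeamTwist L θ) :=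
  PreservesSectors.sum fun _ _ => PreservesSectors.sum fun _ _ => PreservesSectors.sum fun σ _ =>
    (((LiebThm1.preservesSectors_hopping _ _ σ).smul _).add
      ((LiebThm1.preservesSectors_hopping _ _ σ).smul _)).ite _

/-- The twisted `t–t'` torus conserves `N↑` and `N↓` (Watanabe 2019 §2.1). [cite: Watanabe2019, §2.1] -/
theorem preservesSectors_hubbardTorusTT'Flux (t' U θ : ℝ) :
    PreservesSectors (hubbardTorusTT'Flux L t' U θ) :=
  ((LiebThm1.preservesSectors_hamiltonian (fermionTorusGraph 2 L) 1 U).add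
    (LiebThm1.preservesSectors_hamiltonian (fermionTorusDiagGraph L) t' 0)).add
    ((preservesSectors_seamTwist L θ).add ((preservesSectors_diagSeamTwist L θ).smul _))

/-- `[H^{tt'}(θ), N] = 0`: the flux couples to a conserved charge. [cite: Watanabe2019, §2.1] -/
theorem hubbardTorusTT'Flux_commute_totalNumber (t' U θ : ℝ) :
    Commute (hubbardTorusTT'Flux L t' U θ) totalNumber := by
  rw [LiebThm1.totalNumber_eq_diagonal]
  exact (preservesSectors_hubbardTorusTT'Flux L t' U θ).commute_diagonal fun a b => ((a + b : ℕ) : ℂ)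

/-! ### Time reversal: `conj H(θ) = H(−θ)` and `E(−θ) = E(θ)` -/

/-- Complex conjugation reverses the flux of the diagonal seam twist (Byers–Yang 1961). [cite: ByersYang1961] -/
theorem diagSeamTwist_map_conj (θ : ℝ) :
    (diagSeamTwist L θ).map (starRingEnd ℂ) = diagSeamTwist L (-θ) := by
  unfold diagSeamTwist
  simp only [map_conj_sum, map_conj_ite, Matrix.map_add _ (map_add _), map_conj_smul, Matrix.map_mul,
    creation_map_conj, annihilation_map_conj, map_sub, map_one, ← Circle.coe_inv_eq_conj,
    ← Circle.exp_neg, neg_neg]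

/-- **Time reversal**: `conj H^{tt'}(θ) = H^{tt'}(−θ)` entrywise (`H^{tt'}(0)` is a real matrix).
Byers–Yang (1961). [cite: ByersYang1961] -/
theorem hubbardTorusTT'Flux_map_conj (t' U θ : ℝ) :
    (hubbardTorusTT'Flux L t' U θ).map (starRingEnd ℂ) = hubbardTorusTT'Flux L t' U (-θ) := by
  rw [hubbardTorusTT'Flux_eq, hubbardTorusTT'Flux_eq, Matrix.map_add _ (map_add _),
    Matrix.map_add _ (map_add _), hubbardTorusTT', Matrix.map_add _ (map_add _), hamiltonian_map_conj,
    hamiltonian_map_conj, seamTwist_map_conj, map_conj_smul, Complex.conj_ofReal, diagSeamTwist_map_conj]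

/-- **`E(−θ) = E(θ)` in every sector** of the twisted `t–t'` torus. [cite: ByersYang1961] -/
theorem minEnergyOn_hubbardTorusTT'Flux_neg (t' U θ : ℝ) (N : ℕ) (M : ℝ) :
    (hubbardTorusTT'Flux L t' U (-θ)).minEnergyOn (szSector N M) =
      (hubbardTorusTT'Flux L t' U θ).minEnergyOn (szSector N M) := by
  rw [← hubbardTorusTT'Flux_map_conj]
  exact minEnergyOn_map_conj _ _ fun ψ h => star_mem_szSector h

/-- The `t–t'` flux envelope is even: `E^{tt'}_L(−θ) = E^{tt'}_L(θ)` [cite: ByersYang1961] -/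
theorem fluxEnergyTT'_neg (t' U δ θ : ℝ) :
    fluxEnergyTT' L t' U δ (-θ) = fluxEnergyTT' L t' U δ θ :=
  minEnergyOn_hubbardTorusTT'Flux_neg L t' U θ _ _

end Symmetry

end Literature.MathematicalPhysics.QuantumLattice
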